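import Summits.QuantumAdvantage.QuantumAdvantage.Theorems.CharDialCountDialA
import Summits.QuantumAdvantage.QuantumAdvantage.Theorems.PurityDialLawL
import HarnessLib

/-!
# CharDial ▸ CountDial, part B — the threshold: at degree `2p − 2` the count is superexponential (bilinear family, `2^{n²}`)

Part B of «CountDial» (NODE-g24.md §0/§2): the SAME dial is superexponential at degree `2p − 2` — the bilinear family
`f_A(x,y) = [Σ_{A i j} xᵢ yⱼ ≡ 0 (mod p)]` (`bilA`, degree `(p−1)·2` by `PurityDialLaw.hasDegF_ofTests` with one test of degree 2) is injective in
`A` (read `A i j` off the probe point `eᵢ + e'ⱼ`), so ★ `two_pow_sq_le_card_degBool : 2^{n·n} ≤ #degBool p (n+n) (2p−2)`, hence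
`not_expCountAt_twoTwo : ¬ ExpCountAt p (2p−2) C` for every `C` and ★ `not_expCountTwoTwoOdd`.  So EC is sharp exactly at the leaf's threshold.

Kernel standard: no placeholders; axioms [propext, Classical.choice, Quot.sound] only (guards at the end); closed computations by kernel `decide`.
-/

set_option autoImplicit false
set_option linter.dupNamespace false

namespace Summit.QuantumAdvantage.QuantumAdvantage.Theorems.CountDial

open Classical
open Finset
open Summit.QuantumAdvantage.AdviceFreeQNC0
open Literature.Computability.MetaComplexity Literature.Computability.MetaComplexity.Smolensky
open Summit.QuantumAdvantage.QuantumAdvantage.Theorems.TransferDial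
open Summit.QuantumAdvantage.QuantumAdvantage.Theorems.PurityDialLaw (ofTests hasDegF_ofTests)

/-! ## §3 The threshold (kernel): at degree `2p − 2` the count is superexponential -/

section Threshold
variable (p : ℕ) [hp : Fact p.Prime]

/-- The bilinear test `Σ_{i,j : A i j} [xᵢ][yⱼ] ∈ 𝔽_p` on `n + n` bits. -/
def ipA (n : ℕ) (A : Fin n → Fin n → Bool) : (Fin (n + n) → Bool) → ZMod p :=
  fun u => ∑ i : Fin n, ∑ j : Fin n, if A i j = true then mono (ZMod p) ({Fin.castAdd n i, Fin.natAdd n j} : Finset (Fin (n + n))) u else 0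

/-- The bilinear test has degree `≤ 2`. -/
theorem ipA_mem (n : ℕ) (A : Fin n → Fin n → Bool) : ipA p n A ∈ lowDeg (ZMod p) (n + n) 2 := by
  have h : ipA p n A = ∑ i : Fin n, ∑ j : Fin n,
      (if A i j = true then mono (ZMod p) ({Fin.castAdd n i, Fin.natAdd n j} : Finset (Fin (n + n))) else 0) := by
    funext u
    simp only [ipA, Finset.sum_apply]
    refine Finset.sum_congr rfl fun i _ => Finset.sum_congr rfl fun j _ => ?_
    split_ifs <;> rfl
  rw [h]
  refine Submodule.sum_mem _ fun i _ => Submodule.sum_mem _ fun j _ => ?_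
  split_ifs
  · exact mono_mem_lowDeg Finset.card_le_two
  · exact Submodule.zero_mem _

/-- The bilinear family `f_A(x, y) = [Σ_{A i j} xᵢ yⱼ ≡ 0 (mod p)]`. -/
def bilA (n : ℕ) (A : Fin n → Fin n → Bool) : (Fin (n + n) → Bool) → Bool := fun u => decide (ipA p n A u = 0)

/-- Every member of the bilinear family has `𝔽_p`-degree `≤ 2p − 2`. -/
theorem hasDegF_bilA (n : ℕ) (A : Fin n → Fin n → Bool) : HasDegF p (bilA p n A) (2 * p - 2) := by
  have h := hasDegF_ofTests p (K := 1) (e := 2) (fun _ => ipA p n A) (fun _ => ipA_mem p n A) (fun v => decide (v 0 = 0))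
  have e1 : ofTests (fun _ : Fin 1 => ipA p n A) (fun v => decide (v 0 = 0)) = bilA p n A := by
    funext u
    rfl
  have e2 : 1 * (2 * (p - 1)) = 2 * p - 2 := by omega
  rw [e1, e2] at h
  exact h

/-- The probe point `e_i + e'_j`. -/
def probe (n : ℕ) (i j : Fin n) : Fin (n + n) → Bool :=
  fun k => decide (k = Fin.castAdd n i ∨ k = Fin.natAdd n j)

/-- The pair monomial of `(i', j')` at the probe point of `(i, j)` is `[i' = i ∧ j' = j]`. -/
theorem mono_probe (n : ℕ) (i j i' j' : Fin n) :
    mono (ZMod p) ({Fin.castAdd n i', Fin.natAdd n j'} : Finset (Fin (n + n))) (probe n i j) =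
      if i' = i ∧ j' = j then 1 else 0 := by
  rw [mono_apply]
  -- left-block and right-block positions of `Fin (n + n)` are distinct
  have hcn : ∀ a b : Fin n, (Fin.castAdd n a : Fin (n + n)) ≠ Fin.natAdd n b := by
    intro a b h
    have h1 : ((Fin.castAdd n a : Fin (n + n)) : ℕ) = a := rfl
    have h2 : ((Fin.natAdd n b : Fin (n + n)) : ℕ) = n + b := rfl
    have := congrArg Fin.val h
    rw [h1, h2] at this
    have := a.isLt
    omega
  have key : (∀ k ∈ ({Fin.castAdd n i', Fin.natAdd n j'} : Finset (Fin (n + n))), probe n i j k = true) ↔ (i' = i ∧ j' = j) := by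
    simp only [Finset.mem_insert, Finset.mem_singleton, forall_eq_or_imp, forall_eq, probe, decide_eq_true_eq]
    constructor
    · rintro ⟨h1, h2⟩
      refine ⟨?_, ?_⟩
      · rcases h1 with h1 | h1
        · exact Fin.castAdd_injective _ _ h1
        · exact absurd h1 (hcn i' j)
      · rcases h2 with h2 | h2
        · exact absurd h2.symm (hcn i j')
        · exact Fin.natAdd_injective _ _ h2
    · rintro ⟨rfl, rfl⟩
      exact ⟨Or.inl rfl, Or.inr rfl⟩
  by_cases h : i' = i ∧ j' = j
  · rw [if_pos (key.2 h), if_pos h]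
  · rw [if_neg (fun h' => h (key.1 h')), if_neg h]

/-- The bilinear test at the probe point reads off the matrix entry. -/
theorem ipA_probe (n : ℕ) (A : Fin n → Fin n → Bool) (i j : Fin n) :
    ipA p n A (probe n i j) = if A i j = true then 1 else 0 := by
  have hterm : ∀ i' j' : Fin n,
      (if A i' j' = true then mono (ZMod p) ({Fin.castAdd n i', Fin.natAdd n j'} : Finset (Fin (n + n))) (probe n i j) else 0)
        = if (i' = i ∧ j' = j) ∧ A i' j' = true then (1 : ZMod p) else 0 := by
    intro i' j'
    rw [mono_probe]
    by_cases h1 : i' = i ∧ j' = j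
    · by_cases h2 : A i' j' = true
      · rw [if_pos h2, if_pos h1, if_pos ⟨h1, h2⟩]
      · rw [if_neg h2, if_neg (fun h => h2 h.2)]
    · by_cases h2 : A i' j' = true
      · rw [if_pos h2, if_neg h1, if_neg (fun h => h1 h.1)]
      · rw [if_neg h2, if_neg (fun h => h2 h.2)]
  simp only [ipA]
  simp_rw [hterm]
  rw [Finset.sum_eq_single i, Finset.sum_eq_single j]
  · by_cases h2 : A i j = true <;> simp [h2]
  · intro j' _ hj'
    exact if_neg (fun h => hj' h.1.2)
  · intro h; exact absurd (mem_univ j) h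
  · intro i' _ hi'
    exact Finset.sum_eq_zero fun j' _ => if_neg (fun h => hi' h.1.1)
  · intro h; exact absurd (mem_univ i) h

/-- The bilinear family is injective in the matrix. -/
theorem bilA_injective (n : ℕ) : Function.Injective (bilA p n) := by
  intro A A' h
  funext i j
  have h1 := congrFun h (probe n i j)
  simp only [bilA, ipA_probe] at h1
  have one_ne : (1 : ZMod p) ≠ 0 := one_ne_zero
  revert h1
  cases A i j <;> cases A' i j <;> simp [one_ne]

/-- ★ THRESHOLD (kernel): at degree `2p − 2` there are at least `2^{n²}` Boolean functions on `2n` bits — the count is SUPERexponential,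
exactly where the leaf fails (part M: `[Σ xᵢyᵢ ≡ 0]`). -/
theorem two_pow_sq_le_card_degBool (n : ℕ) : 2 ^ (n * n) ≤ (degBool p (n + n) (2 * p - 2)).card := by
  have hsub : univ.image (bilA p n) ⊆ degBool p (n + n) (2 * p - 2) := by
    intro f hf
    rw [mem_image] at hf
    obtain ⟨A, _, rfl⟩ := hf
    rw [degBool, mem_filter]
    exact ⟨mem_univ _, hasDegF_bilA p n A⟩
  calc 2 ^ (n * n) = (univ : Finset (Fin n → Fin n → Bool)).card := by
        simp only [card_univ, Fintype.card_fun, Fintype.card_fin, Fintype.card_bool]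
        rw [← pow_mul, mul_comm]
    _ = (univ.image (bilA p n)).card := (card_image_of_injective _ (bilA_injective p n)).symm
    _ ≤ _ := card_le_card hsub

/-- Hence NO exponential count at degree `2p − 2`: `¬ ExpCountAt p (2p − 2) C` for every `C` (take `n = 3C + 1`). -/
theorem not_expCountAt_twoTwo (C : ℕ) : ¬ ExpCountAt p (2 * p - 2) C := by
  intro h
  set n := 3 * C + 1 with hn
  have h1 := (two_pow_sq_le_card_degBool p n).trans (h (n + n))
  -- `2^{n²} ≤ C^{2n+1}` is absurd for `n = 3C + 1`
  have hC : C ≤ 2 ^ C := (Nat.lt_two_pow_self).le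
  have h2 : C ^ (n + n + 1) ≤ (2 ^ C) ^ (n + n + 1) := Nat.pow_le_pow_left hC _
  rw [← pow_mul] at h2
  have h3 : 2 ^ (n * n) ≤ 2 ^ (C * (n + n + 1)) := h1.trans h2
  have h4 := (Nat.pow_le_pow_iff_right (by norm_num : 1 < 2)).1 h3
  rw [hn] at h4
  nlinarith

end Threshold

/-- The threshold in the shape of EC: `ExpCountTwoTwoOdd` (degree `2p − 2`) is FALSE. -/
def ExpCountTwoTwoOdd : Prop := ∀ (p : ℕ) [Fact p.Prime], 5 ≤ p → ∃ C : ℕ, ExpCountAt p (2 * p - 2) C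

/-- ★ kernel: `¬ ExpCountTwoTwoOdd` (witness `p = 5`). -/
theorem not_expCountTwoTwoOdd : ¬ ExpCountTwoTwoOdd := by
  intro h
  haveI : Fact (Nat.Prime 5) := ⟨by norm_num⟩
  obtain ⟨C, hC⟩ := h 5 (le_refl 5)
  exact not_expCountAt_twoTwo 5 C hC

/-! ### Axiom guards -/

/-- info: 'Summit.QuantumAdvantage.QuantumAdvantage.Theorems.CountDial.two_pow_sq_le_card_degBool' depends on axioms: [propext,
 choice,
 Quot.sound] -/
#guard_msgs in #print axioms two_pow_sq_le_card_degBool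

/-- info: 'Summit.QuantumAdvantage.QuantumAdvantage.Theorems.CountDial.not_expCountTwoTwoOdd' depends on axioms: [propext,
 choice,
 Quot.sound] -/
#guard_msgs in #print axioms not_expCountTwoTwoOdd

end Summit.QuantumAdvantage.QuantumAdvantage.Theorems.CountDial
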